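/-
Copyright (c) 2026. All rights reserved.
Released under Apache 2.0 license as described in the file LICENSE.
-/
import Literature.NumberTheory.ComplexMultiplication.DegenerateCMTypesCyclicTwoOddPrimes
import Literature.AlgebraicGeometry.Pohlmann1968.SimpleDegenerateCMAbelianVarietiesCompositeDimension
import Literature.NumberTheory.ComplexMultiplication.AbelianCMFieldsCyclicOverImaginaryQuadratic
import Literature.AlgebraicGeometry.Pohlmann1968.MumfordSimpleFourfoldOfPrimitive
import Literature.AlgebraicGeometry.Pohlmann1968.NondegenerateCMTypeHodgeConjecture
import Literature.AlgebraicGeometry.ComplexMultiplication.CMAbelianVarietyRealisedHolds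
import HarnessLib

/-!
# Hazama's Theorem 4.8 for an ARBITRARY cyclic CM field of degree `2pq`: degenerate and primitive CM types read
# on the Galois group, exceptional Hodge classes of codimension `p` on the `p`-dominated abelian varieties, and
# simple degenerate abelian `pq`-folds with `Bᵖ ≠ Dᵖ` for every pair of distinct odd primes

Number-field / abelian-variety dress, in Hazama's own generality («a cyclic galois CM-field of degree `2pq`»), of the
group-level file `NumberTheory/ComplexMultiplication/DegenerateCMTypesCyclicTwoOddPrimes` (Thm. 4.8 on a frame
`CyclicFrame p q ρ τ κ`); the special fields `ℚ(ζ_ℓ)`, `ℓ = 2pq + 1` prime, are treated on residues in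
`AlgebraicGeometry/ComplexMultiplication/CyclotomicDegenerateCMTypesTwoOddPrimes`.  THEOREMS ONLY (no definition, no
named fact, no `sorry`).

## The print

F. Hazama, *Hodge cycles on abelian varieties with complex multiplication by cyclic CM-fields*, J. Math. Sci. Univ.
Tokyo **10** (2003) 581–598 [Hazama2003CyclicCM] (held text `paper:w2141840783`), THEOREM 4.8 (p. 594): «Let
`p, q` be distinct odd primes. Let `CM` denote the set of CM-types for a cyclic galois CM-field of degree `2pq`. Let
`Deg` denote the subset of `CM` consisting of degenerate CM-types, and `Prim` (resp. `NonPrim`) the subset of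
primitive (resp. nonprimitive) CM-types. Let `N Dom` denote the subset of `CM` consisting of `N`-dominated
CM-types. … (ii) `Deg = S₁ ∪ S_p ∪ S_q` … (iii) `Nonprim = S₁`, (iv) `Prim ∩ p-Dom = S_p − S₁`,
(v) `Prim ∩ q-Dom = S_q − S₁`, (vi) all the primitive and degenerate CM-types are `1`-degenerate»; §5 (p. 596–597:
the weight-`p` height-one kernel elements); REMARK 4.9 (effective Lenstra–Stark); REMARK 4.10 («for any abelian
variety `A` with complex multiplication by an abelian CM-field, there always exists a nondivisorial Hodge cycle on `A`
itself if `A` is degenerate (see [7])»).  B. B. Gordon, *A survey of the Hodge conjecture for abelian varieties*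
[Gordon1999HodgeAVSurvey], 9.2.2 (Pohlmann / White: on a simple `A` a Galois-balanced set `Δ` of `2m` embeddings
with some `φ ∈ Δ`, `φ̄ ∉ Δ` gives a Hodge `(m,m)`-class outside `Dᵐ`), Thm. 6.4 and §9.3 (nondegenerate ⟹
`Hdg(Aᵏ) = Div(Aᵏ)`).  B. Dodson, Trans. AMS 283 (1984) [Dodson1984], §3.2.1 (CM fields with `Gal(K/ℚ) = ⟨ρ⟩ × ℤₙ`
exist for every `n` — tree `Dodson1984.exists_abelianCMField_gal_cyclicTimesConj`).

## Setting

`K` a CM field, normal over `ℚ`, with COMMUTATIVE Galois group (`[IsMulCommutative (K ≃ₐ[ℚ] K)]`; the bundled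
`CommGroup` instance is Mathlib's scoped `IsMulCommutative` one), `φ₀ : K → ℂ` a base embedding, `ρ ∈ Gal(K/ℚ)` the
complex conjugation (`φ₀ ∘ ρ = conj ∘ φ₀`), and `τ, κ ∈ Gal(K/ℚ)` of orders `p, q` with `[K : ℚ] = 2pq` — so that
`Gal(K/ℚ) = ⟨ρ⟩ × ⟨τ⟩ × ⟨κ⟩` is cyclic of order `2pq` and `CyclicFrame p q ρ τ κ` holds (`cyclicFrame_gal`,
`exists_cyclicFrame_gal`).  A CM type `Φ` of `K` (`Motives.CMType`) is read on the Galois group in Shimura's indexing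
`σ_g = φ₀ ∘ g⁻¹` (`Pohlmann1968.embOf`): `𝓖[φ₀, Φ] = {g | σ_g ∈ Φ}` — LOCAL NOTATION for
`Finset.univ.filter fun g => embOf φ₀ g ∈ Φ.1`; `Rank(K; Φ) = rank(𝓖[φ₀,Φ])` is the tree's
`cmTypeRank_eq_typeRank_gal`, and `𝓖[φ₀,Φ]` is a CM type for `ρ` (`isCMTypeWith_gal`).

## What is proved

* §1 `cyclicFrame_gal`, `exists_cyclicFrame_gal`, `finrank_div_two_eq`, `isCMTypeWith_galType`,
  `cmTypeRank_eq_typeRank_galType`, `forall_smul_mem_iff_iff` (the `Aut(ℂ)`-translates of `σ_g`, `σ_h` agree on `Φ`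
  iff the `Gal`-translates of `g`, `h` agree on `𝓖[φ₀,Φ]`), `exists_cmType_of_isCMTypeWith` (every group-level CM
  type is `𝓖[φ₀, Φ]` for a CM type `Φ` of `K`).
* §2 THEOREM 4.8 for `K`: **`not_isNondegenerate_iff`** ((ii): `Φ` degenerate iff constant rows ∨ constant columns ∨
  `τ`-stable ∨ `κ`-stable), `isNondegenerate_iff`, **`isPrimitive_iff`** ((iii): `Φ` primitive iff no `u ≠ 1`
  stabilises `𝓖[φ₀,Φ]`), **`not_isNondegenerate_iff_of_primitive`** ((ii)+(iii)+4.5: the primitive degenerate types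
  are the `p`-dominated and the `q`-dominated ones, exclusively), **`cmTypeRank_eq_of_hasConstantRows`** (a primitive
  `p`-dominated type has `Rank = (p−1)q + 2`), `cmTypeRank_add_defect_eq`.
* §3 on every abelian variety `(A, ι, θ)` of type `(K; Φ)` read on `H¹`: `dim_eq` (`pq`), `isSimple_iff`
  (simple iff no non-trivial stabiliser), **`exists_exceptional_of_hasConstantRows`** ((iv)+§5+9.2.2: for `Φ`
  primitive `p`-dominated, a rational `(p,p)`-class on `A` OUTSIDE `Dᵖ(A) ⊗ ℂ` — the §5 kernel element
  `Δ(0,1) = {σ_{τˣ}} ∪ {σ_{ρτˣκ}}` is Galois-balanced and not conjugation-symmetric),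
  `exists_exceptional_of_hasConstantCols`, **`exists_exceptional_of_not_isNondegenerate`** (REMARK 4.10 for the
  cyclic CM fields of degree `2pq`, constructively: primitive + degenerate ⟹ a nondivisorial Hodge class ON `A`
  ITSELF, in codimension `p` or `q`), **`hodgeConjectureFor_pow_of_not_mem`** (none of the four conditions ⟹ the
  Hodge conjecture for every power of `A`, unconditionally).
* §4 REMARK 4.9 for every such `K`: **`exists_primitive_degenerate`** (`K` carries a PRIMITIVE DEGENERATE CM type of
  rank `(p−1)q + 2` all of whose abelian varieties are simple `pq`-folds with a rational `(p,p)`-class outside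
  `Dᵖ ⊗ ℂ`), and, with Dodson's fields and Shimura's existence theorem (tree `exists_isCMTypeRealisation`),
  **`exists_simple_exceptional_codim`**: for EVERY pair of distinct odd primes `p, q` there is a simple abelian
  variety of dimension `pq` with complex multiplication by a cyclic CM field of degree `2pq` carrying a Hodge
  `(p,p)`-class that is not a polynomial in divisor classes.
* §5 (gen 68) HAZAMA'S COUNT (Prop. 3.2 + §5: the weight-`p` `{0, ±1}`-vectors `±w_k^{(2q)}`, `w_k^{(2q)} − w_l^{(2q)}` of
  `V_{2q} ∩ ℤ[ℤ/2n]`, `q(q−1)` of them): `hazamaSet_injective` (the kernel sets `Δ(y₁, y₂)` are pairwise distinct),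
  **`mul_sub_one_le_finrank_sub_of_hasConstantRows`** (`Φ` primitive `p`-dominated ⟹ `dim Bᵖ(A) − dim Dᵖ(A) ≥ q(q − 1)` on
  every realisation), `mul_sub_one_le_finrank_sub_of_hasConstantCols` (`≥ p(p − 1)` in codimension `q`),
  `mul_sub_one_le_finrank_sub_of_not_isNondegenerate` (primitive degenerate ⟹ one of the two), and for every pair of distinct
  odd primes **`exists_simple_mul_sub_one_le_finrank_sub`** (a simple CM `pq`-fold with `dim Bᵖ − dim Dᵖ ≥ q(q−1)`).  The general
  form (any abelian CM field, any admissible kernel with an odd prime factor: `≥ [G:H]·Π(p_i−1)/2`) is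
  `Pohlmann1968/MixedDifferenceCubeExponentFamilies` (gen 68).

## References

* [Hazama2003CyclicCM] F. Hazama, J. Math. Sci. Univ. Tokyo 10 (2003) 581–598, Thm. 4.8, §5, Rem. 4.9–4.10.
* [Gordon1999HodgeAVSurvey] B. B. Gordon, *A survey of the Hodge conjecture for abelian varieties*, 9.2.2, Thm. 6.4.
* [Dodson1984] B. Dodson, Trans. AMS 283 (1984), §3.2.1.
* [Kubota1965] T. Kubota, Trans. AMS 118 (1965), §4 Lemma 2.
* [Shimura1998] G. Shimura, *Abelian Varieties with Complex Multiplication and Modular Functions*, §8.1, §8.2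
  Prop. 26, §18.2, §6.2 Thm. 3.
* [Pohlmann1968] H. Pohlmann, Ann. of Math. 88 (1968), Thm. 1 and §3.

## Provenance

Cell `pub-hodgecm2` (COR-CM), literature seat `lit-deligne-3` gen 18 (claim HAZAMA-CYCLIC-2PQ; count-neutral); §5 and
`AllPairsCount` appended by `lit-deligne-3` gen 68 (claim HAZAMA-COUNT; count-neutral, theorems only).
-/

set_option autoImplicit false

noncomputable section

open scoped BigOperators NumberField IsMulCommutative Classical
open CategoryTheory NumberField

namespace Literature.AlgebraicGeometry.Pohlmann1968

namespace CyclicTwoOddPrimes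

open Literature.NumberTheory.ComplexMultiplication
open Literature.NumberTheory.ComplexMultiplication.CyclicCMType
open Literature.AlgebraicGeometry.Motives (AbelianVariety CMType)
open Literature.AlgebraicGeometry.HodgeTheory
open Literature.AlgebraicGeometry.ComplexMultiplication (IsCMTypeRealisation isSimple_iff_isPrimitive
  exists_isCMTypeRealisation)
open Literature.Barriers.HodgeConjecture (divisorClassesSpan)

/-- `𝓖[φ₀, Φ] = {g ∈ Gal(K/ℚ) : σ_g = φ₀ ∘ g⁻¹ ∈ Φ}` — the CM type read on the Galois group (local notation). -/
local notation3 "𝓖[" φ₀ ", " Φ "]" =>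
  Finset.filter (fun g => embOf φ₀ g ∈ (Φ : CMType _).1) Finset.univ

variable {K : Type} [Field K] [NumberField K] [Normal ℚ K] [IsMulCommutative (K ≃ₐ[ℚ] K)]
variable {p q : ℕ} {ρ τ κ : K ≃ₐ[ℚ] K} {φ₀ : K →+* ℂ}

/-! ## §1 The frame on `Gal(K/ℚ)` and the type read on it -/

section Frame

omit [Normal ℚ K] in
/-- Commutativity of `Gal(K/ℚ)` in the form the tree's lemmas consume. [cite: Kubota1965, §4 Lemma 2] -/
theorem gal_comm : ∀ g h : K ≃ₐ[ℚ] K, g * h = h * g := fun g h => mul_comm g h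

/-- **The frame `(Gal(K/ℚ); ρ, τ, κ)`**: for `[K : ℚ] = 2pq`, `ρ` the complex conjugation and `τ, κ` of orders
`p, q`, `CyclicFrame p q ρ τ κ` holds. [cite: Hazama2003CyclicCM, §2 and Thm. 4.8] [cite: Shimura1998, §18.2 Lemma (i)] -/
theorem cyclicFrame_gal [IsCMField K] (hρ : ∀ x, φ₀ (ρ x) = starRingEnd ℂ (φ₀ x)) (hp : p.Prime) (hq : q.Prime) (hpq : p ≠ q)
    (hp2 : p ≠ 2) (hq2 : q ≠ 2) (hK : Module.finrank ℚ K = 2 * (p * q)) (hτ : orderOf τ = p)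
    (hκ : orderOf κ = q) : CyclicFrame p q ρ τ κ where
  prime_left := hp
  prime_right := hq
  ne := hpq
  left_ne_two := hp2
  right_ne_two := hq2
  rho_ne_one := conjGalElt_ne_one hρ
  rho_mul_rho := conjGalElt_mul_self hρ
  orderOf_tau := hτ
  orderOf_kappa := hκ
  card_eq := by rw [card_gal_eq_finrank φ₀, hK]

/-- **Frames exist**: for `[K : ℚ] = 2pq` the Galois group has elements of orders `p` and `q` (Cauchy).
[cite: Hazama2003CyclicCM, §2] -/
theorem exists_cyclicFrame_gal [IsCMField K] (hρ : ∀ x, φ₀ (ρ x) = starRingEnd ℂ (φ₀ x)) (hp : p.Prime) (hq : q.Prime)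
    (hpq : p ≠ q) (hp2 : p ≠ 2) (hq2 : q ≠ 2) (hK : Module.finrank ℚ K = 2 * (p * q)) :
    ∃ τ κ : K ≃ₐ[ℚ] K, CyclicFrame p q ρ τ κ := by
  haveI := Fact.mk hp
  haveI := Fact.mk hq
  have hcard : Fintype.card (K ≃ₐ[ℚ] K) = 2 * (p * q) := by rw [card_gal_eq_finrank φ₀, hK]
  obtain ⟨τ, hτ⟩ := exists_prime_orderOf_dvd_card p
    (show p ∣ Fintype.card (K ≃ₐ[ℚ] K) by rw [hcard]; exact dvd_mul_of_dvd_right (dvd_mul_right p q) 2)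
  obtain ⟨κ, hκ⟩ := exists_prime_orderOf_dvd_card q
    (show q ∣ Fintype.card (K ≃ₐ[ℚ] K) by rw [hcard]; exact dvd_mul_of_dvd_right (dvd_mul_left q p) 2)
  exact ⟨τ, κ, cyclicFrame_gal hρ hp hq hpq hp2 hq2 hK hτ hκ⟩

/-- `[K : ℚ]/2 = pq` on a frame. [cite: Shimura1998, §8.1] -/
theorem finrank_div_two_eq (φ₀ : K →+* ℂ) (hF : CyclicFrame p q ρ τ κ) : Module.finrank ℚ K / 2 = p * q := by
  rw [← card_gal_eq_finrank φ₀, hF.card_eq, Nat.mul_div_cancel_left _ two_pos]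

omit [Normal ℚ K] [IsMulCommutative (K ≃ₐ[ℚ] K)] in
/-- The type read on the Galois group, as a set. [cite: Shimura1998, §8.1] -/
theorem coe_galType (Φ : CMType K) :
    (↑𝓖[φ₀, Φ] : Set (K ≃ₐ[ℚ] K)) = {g : K ≃ₐ[ℚ] K | embOf φ₀ g ∈ Φ.1} := by
  ext g; simp

omit [Normal ℚ K] [IsMulCommutative (K ≃ₐ[ℚ] K)] in
/-- Membership in `𝓖[φ₀, Φ]`. [cite: Shimura1998, §8.1] -/
theorem mem_galType_iff (Φ : CMType K) (g : K ≃ₐ[ℚ] K) : g ∈ 𝓖[φ₀, Φ] ↔ embOf φ₀ g ∈ Φ.1 := by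
  simp

omit [Normal ℚ K] in
/-- **`𝓖[φ₀, Φ]` is a CM type for `ρ`** (`σ̄_g = σ_{ρg}`). [cite: Shimura1998, §18.2 Lemma (i)] -/
theorem isCMTypeWith_galType (hρ : ∀ x, φ₀ (ρ x) = starRingEnd ℂ (φ₀ x)) (Φ : CMType K) :
    IsCMTypeWith ρ (↑𝓖[φ₀, Φ] : Set (K ≃ₐ[ℚ] K)) := by
  rw [coe_galType]
  exact isCMTypeWith_gal gal_comm Φ φ₀ ρ hρ

/-- **`Rank(K; Φ)` is the group-level rank of `𝓖[φ₀, Φ]`.** [cite: Kubota1965, §4 Lemma 2] -/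
theorem cmTypeRank_eq_typeRank_galType (Φ : CMType K) (φ₀ : K →+* ℂ) :
    cmTypeRank Φ = typeRank (K ≃ₐ[ℚ] K) (↑𝓖[φ₀, Φ] : Set (K ≃ₐ[ℚ] K)) := by
  rw [coe_galType]
  exact cmTypeRank_eq_typeRank_gal gal_comm Φ φ₀

/-- **`Aut(ℂ)`-translates versus `Gal`-translates**: the translates of `σ_g` and `σ_h` have the same pattern in `Φ`
iff the translates of `g` and `h` have the same pattern in `𝓖[φ₀, Φ]` (`γ ∘ σ_g = σ_{δ⁻¹ g}` when
`γ ∘ φ₀ = φ₀ ∘ δ`). [cite: Shimura1998, §8.1] -/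
theorem forall_smul_mem_iff_iff (Φ : CMType K) (g h : K ≃ₐ[ℚ] K) :
    (∀ γ : ℂ ≃+* ℂ, γ • embOf φ₀ g ∈ Φ.1 ↔ γ • embOf φ₀ h ∈ Φ.1) ↔
      ∀ δ : K ≃ₐ[ℚ] K, δ * g ∈ 𝓖[φ₀, Φ] ↔ δ * h ∈ 𝓖[φ₀, Φ] := by
  constructor
  · intro H δ
    obtain ⟨γ, hγ⟩ := exists_ringEquiv_comp_eq_algEquiv φ₀ δ⁻¹
    have h1 := H γ
    rw [smul_embOf_of_comp φ₀ hγ, smul_embOf_of_comp φ₀ hγ, inv_inv, mul_comm g δ, mul_comm h δ] at h1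
    rw [mem_galType_iff, mem_galType_iff]
    exact h1
  · intro H γ
    obtain ⟨δ, hδ⟩ := exists_algEquiv_comp_eq_smul φ₀ γ
    have h1 := H δ⁻¹
    rw [mem_galType_iff, mem_galType_iff] at h1
    rw [smul_embOf_of_comp φ₀ hδ, smul_embOf_of_comp φ₀ hδ, mul_comm g, mul_comm h]
    exact h1

/-- **Every group-level CM type comes from a CM type of `K`**: for `Φ_G ⊆ Gal(K/ℚ)` a CM type for `ρ` there is a
CM type `Φ` of `K` with `𝓖[φ₀, Φ] = Φ_G`. [cite: Shimura1998, §18.2 Lemma (i)] -/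
theorem exists_cmType_of_isCMTypeWith (hρ : ∀ x, φ₀ (ρ x) = starRingEnd ℂ (φ₀ x)) {ΦG : Finset (K ≃ₐ[ℚ] K)}
    (h : IsCMTypeWith ρ (ΦG : Set (K ≃ₐ[ℚ] K))) : ∃ Φ : CMType K, 𝓖[φ₀, Φ] = ΦG := by
  have hinj := (embOf_bijective φ₀).1
  have hmem : ∀ g' : K ≃ₐ[ℚ] K, (embOf φ₀ g' ∈ {φ : K →+* ℂ | ∃ g ∈ ΦG, embOf φ₀ g = φ}) ↔ g' ∈ ΦG :=
    fun g' => ⟨fun ⟨g, hg, he⟩ => hinj he ▸ hg, fun hg => ⟨g', hg, rfl⟩⟩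
  refine ⟨⟨{φ | ∃ g ∈ ΦG, embOf φ₀ g = φ}, fun φ => ?_⟩, ?_⟩
  · obtain ⟨g, rfl⟩ := (embOf_bijective φ₀).2 φ
    rw [conjugate_embOf gal_comm hρ, hmem, hmem]
    have := h.mem_iff g
    simpa [smul_eq_mul] using this
  · ext g
    rw [mem_galType_iff]
    exact hmem g

end Frame

/-! ## §2 Theorem 4.8 for the CM types of `K` -/

section Theorem

/-- **THEOREM 4.8 (ii): `Deg = S₁ ∪ S_p ∪ S_q`.**  A CM type `Φ` of the cyclic CM field `K` of degree `2pq` is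
DEGENERATE iff its Galois-level type has constant row counts (`S_p`), or constant column counts (`S_q`), or is stable
under `τ` or under `κ` (`S₁`). [cite: Hazama2003CyclicCM, Thm. 4.8 (ii)–(iii)] [cite: Kubota1965, §4 Lemma 2] -/
theorem not_isNondegenerate_iff (hF : CyclicFrame p q ρ τ κ) (hρ : ∀ x, φ₀ (ρ x) = starRingEnd ℂ (φ₀ x))
    (Φ : CMType K) :
    haveI : NeZero p := ⟨hF.prime_left.ne_zero⟩
    haveI : NeZero q := ⟨hF.prime_right.ne_zero⟩
    ¬ IsNondegenerate Φ ↔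
      HasConstantRows p q 𝓖[φ₀, Φ] τ κ ∨ HasConstantRows q p 𝓖[φ₀, Φ] κ τ ∨
        IsStableUnder 𝓖[φ₀, Φ] τ ∨ IsStableUnder 𝓖[φ₀, Φ] κ := by
  rw [_root_.Literature.AlgebraicGeometry.Pohlmann1968.isNondegenerate_iff, cmTypeRank_eq_typeRank_galType Φ φ₀,
    finrank_div_two_eq φ₀ hF]
  exact typeRank_ne_iff hF (isCMTypeWith_galType hρ Φ)

/-- **THEOREM 4.8 (ii), nondegenerate form.** [cite: Hazama2003CyclicCM, Thm. 4.8 (ii)] -/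
theorem isNondegenerate_iff (hF : CyclicFrame p q ρ τ κ) (hρ : ∀ x, φ₀ (ρ x) = starRingEnd ℂ (φ₀ x))
    (Φ : CMType K) :
    haveI : NeZero p := ⟨hF.prime_left.ne_zero⟩
    haveI : NeZero q := ⟨hF.prime_right.ne_zero⟩
    IsNondegenerate Φ ↔
      ¬ HasConstantRows p q 𝓖[φ₀, Φ] τ κ ∧ ¬ HasConstantRows q p 𝓖[φ₀, Φ] κ τ ∧
        ¬ IsStableUnder 𝓖[φ₀, Φ] τ ∧ ¬ IsStableUnder 𝓖[φ₀, Φ] κ := by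
  rw [_root_.Literature.AlgebraicGeometry.Pohlmann1968.isNondegenerate_iff, cmTypeRank_eq_typeRank_galType Φ φ₀,
    finrank_div_two_eq φ₀ hF]
  exact typeRank_eq_iff hF (isCMTypeWith_galType hρ Φ)

/-- **THEOREM 4.8 (iii): `Nonprim = S₁`.**  `Φ` is PRIMITIVE (the tree's `IsPrimitive`, Shimura §8.2 Prop. 26, at any
base embedding `φh`) iff no `u ≠ 1` in `Gal(K/ℚ)` stabilises `𝓖[φ₀, Φ]`.
[cite: Hazama2003CyclicCM, Thm. 4.8 (iii) and Prop. 2.3] [cite: Shimura1998, §8.2 Prop. 26] -/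
theorem isPrimitive_iff (Φ : CMType K) (φh : K →+* ℂ) :
    IsPrimitive (ℂ ≃+* ℂ) Φ.1 φh ↔ ∀ u : K ≃ₐ[ℚ] K, u ≠ 1 → ¬ IsStableUnder 𝓖[φ₀, Φ] u := by
  haveI := isPretransitive_ringEquiv_complex (K := K)
  rw [isPrimitive_iff_forall_eq]
  have key : (∀ x y : K →+* ℂ, (∀ γ : ℂ ≃+* ℂ, γ • x ∈ Φ.1 ↔ γ • y ∈ Φ.1) → x = y) ↔
      ∀ g h : K ≃ₐ[ℚ] K, (∀ δ : K ≃ₐ[ℚ] K, δ • g ∈ (↑𝓖[φ₀, Φ] : Set (K ≃ₐ[ℚ] K)) ↔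
        δ • h ∈ (↑𝓖[φ₀, Φ] : Set (K ≃ₐ[ℚ] K))) → g = h := by
    constructor
    · intro H g h hgh
      apply (embOf_bijective φ₀).1
      refine H _ _ ((forall_smul_mem_iff_iff Φ g h).2 fun δ => ?_)
      simpa [smul_eq_mul] using hgh δ
    · intro H x y hxy
      obtain ⟨g, rfl⟩ := (embOf_bijective φ₀).2 x
      obtain ⟨h, rfl⟩ := (embOf_bijective φ₀).2 y
      rw [H g h fun δ => by simpa [smul_eq_mul] using (forall_smul_mem_iff_iff Φ g h).1 hxy δ]
  rw [key]
  have h2 := exists_isStableUnder_iff_not_separating (𝓖[φ₀, Φ])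
  constructor
  · intro H u hu1 hu
    exact (h2.1 ⟨u, hu1, hu⟩) H
  · intro H
    by_contra hsep
    obtain ⟨u, hu1, hu⟩ := h2.2 hsep
    exact H u hu1 hu

/-- Primitivity through `τ` and `κ` only (Prop. 2.3). [cite: Hazama2003CyclicCM, Prop. 2.3 and Thm. 4.8 (iii)] -/
theorem isPrimitive_iff_not_isStableUnder (hF : CyclicFrame p q ρ τ κ) (hρ : ∀ x, φ₀ (ρ x) = starRingEnd ℂ (φ₀ x))
    (Φ : CMType K) (φh : K →+* ℂ) :
    IsPrimitive (ℂ ≃+* ℂ) Φ.1 φh ↔ ¬ IsStableUnder 𝓖[φ₀, Φ] τ ∧ ¬ IsStableUnder 𝓖[φ₀, Φ] κ := by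
  rw [isPrimitive_iff (φ₀ := φ₀) Φ φh]
  have key := exists_isStableUnder_iff hF (isCMTypeWith_galType hρ Φ)
  constructor
  · intro H
    have : ¬ ∃ u : K ≃ₐ[ℚ] K, u ≠ 1 ∧ IsStableUnder 𝓖[φ₀, Φ] u := fun ⟨u, hu1, hu⟩ => H u hu1 hu
    rw [key] at this
    push Not at this
    exact this
  · rintro ⟨hτ, hκ⟩ u hu1 hu
    have : ∃ u : K ≃ₐ[ℚ] K, u ≠ 1 ∧ IsStableUnder 𝓖[φ₀, Φ] u := ⟨u, hu1, hu⟩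
    rw [key] at this
    exact this.elim hτ hκ

/-- **THEOREM 4.8 (ii)+(iii)+(iv)+(v): the PRIMITIVE DEGENERATE types are `(S_p − S₁) ⊔ (S_q − S₁)`** — a
primitive `Φ` is degenerate iff EXACTLY ONE of constant rows (`p`-dominated) / constant columns (`q`-dominated)
holds. [cite: Hazama2003CyclicCM, Thm. 4.8 (ii)–(v) and Prop. 4.5] -/
theorem not_isNondegenerate_iff_of_primitive (hF : CyclicFrame p q ρ τ κ)
    (hρ : ∀ x, φ₀ (ρ x) = starRingEnd ℂ (φ₀ x)) (Φ : CMType K)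
    (hprim : ∀ u : K ≃ₐ[ℚ] K, u ≠ 1 → ¬ IsStableUnder 𝓖[φ₀, Φ] u) :
    haveI : NeZero p := ⟨hF.prime_left.ne_zero⟩
    haveI : NeZero q := ⟨hF.prime_right.ne_zero⟩
    ¬ IsNondegenerate Φ ↔
      (HasConstantRows p q 𝓖[φ₀, Φ] τ κ ∧ ¬ HasConstantRows q p 𝓖[φ₀, Φ] κ τ) ∨
        (HasConstantRows q p 𝓖[φ₀, Φ] κ τ ∧ ¬ HasConstantRows p q 𝓖[φ₀, Φ] τ κ) := by
  rw [_root_.Literature.AlgebraicGeometry.Pohlmann1968.isNondegenerate_iff, cmTypeRank_eq_typeRank_galType Φ φ₀,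
    finrank_div_two_eq φ₀ hF]
  exact typeRank_ne_iff_of_primitive hF (isCMTypeWith_galType hρ Φ) hprim

/-- A `p`-dominated type is degenerate. [cite: Hazama2003CyclicCM, Prop. 4.3 and Thm. 4.8 (ii)] -/
theorem not_isNondegenerate_of_hasConstantRows (hF : CyclicFrame p q ρ τ κ)
    (hρ : ∀ x, φ₀ (ρ x) = starRingEnd ℂ (φ₀ x)) (Φ : CMType K)
    (hr : haveI : NeZero p := ⟨hF.prime_left.ne_zero⟩; HasConstantRows p q 𝓖[φ₀, Φ] τ κ) :
    ¬ IsNondegenerate Φ :=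
  (not_isNondegenerate_iff hF hρ Φ).2 (Or.inl hr)

/-- **The rank of a primitive `p`-dominated type: `Rank(K; Φ) = (p − 1)q + 2`** (defect `q − 1`: §5, the kernel is
spanned by the `q − 1` elements `w_k^{(2q)}`; `dim Hg(A) = pq − q + 1`).
[cite: Hazama2003CyclicCM, §5 (p. 597), Prop. 2.1 and Thm. 4.8 (iv)] [cite: Kubota1965, §4 Lemma 2] -/
theorem cmTypeRank_eq_of_hasConstantRows (hF : CyclicFrame p q ρ τ κ)
    (hρ : ∀ x, φ₀ (ρ x) = starRingEnd ℂ (φ₀ x)) (Φ : CMType K)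
    (hprim : ∀ u : K ≃ₐ[ℚ] K, u ≠ 1 → ¬ IsStableUnder 𝓖[φ₀, Φ] u)
    (hr : haveI : NeZero p := ⟨hF.prime_left.ne_zero⟩; HasConstantRows p q 𝓖[φ₀, Φ] τ κ) :
    cmTypeRank Φ = (p - 1) * q + 2 := by
  rw [cmTypeRank_eq_typeRank_galType Φ φ₀]
  exact typeRank_eq_of_primitive_of_hasConstantRows hF (isCMTypeWith_galType hρ Φ) hprim hr

/-- **The rank of a primitive `q`-dominated type: `(q − 1)p + 2`.** [cite: Hazama2003CyclicCM, §5 and Thm. 4.8 (v)] -/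
theorem cmTypeRank_eq_of_hasConstantCols (hF : CyclicFrame p q ρ τ κ)
    (hρ : ∀ x, φ₀ (ρ x) = starRingEnd ℂ (φ₀ x)) (Φ : CMType K)
    (hprim : ∀ u : K ≃ₐ[ℚ] K, u ≠ 1 → ¬ IsStableUnder 𝓖[φ₀, Φ] u)
    (hc : haveI : NeZero q := ⟨hF.prime_right.ne_zero⟩; HasConstantRows q p 𝓖[φ₀, Φ] κ τ) :
    cmTypeRank Φ = (q - 1) * p + 2 :=
  cmTypeRank_eq_of_hasConstantRows hF.swap hρ Φ hprim hc

/-- **Rank plus defect = `pq + 1`** (Prop. 2.1 with Thm. 4.8). [cite: Hazama2003CyclicCM, Prop. 2.1 and Thm. 4.8 (ii)]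
[cite: Kubota1965, §4 Lemma 2] -/
theorem cmTypeRank_add_defect_eq (hF : CyclicFrame p q ρ τ κ) (hρ : ∀ x, φ₀ (ρ x) = starRingEnd ℂ (φ₀ x))
    (Φ : CMType K) :
    haveI : NeZero p := ⟨hF.prime_left.ne_zero⟩
    haveI : NeZero q := ⟨hF.prime_right.ne_zero⟩
    cmTypeRank Φ +
        ((if HasConstantRows p q 𝓖[φ₀, Φ] τ κ then q - 1 else 0) +
          (if HasConstantRows q p 𝓖[φ₀, Φ] κ τ then p - 1 else 0) +
          (if IsStableUnder 𝓖[φ₀, Φ] τ ∨ IsStableUnder 𝓖[φ₀, Φ] κ then (p - 1) * (q - 1) else 0)) =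
      p * q + 1 := by
  rw [cmTypeRank_eq_typeRank_galType Φ φ₀]
  exact typeRank_add_defect_eq hF (isCMTypeWith_galType hρ Φ)

end Theorem

/-! ## §3 On abelian varieties of type `(K; Φ)` -/

section AbelianVarieties

variable {Φ : CMType K}
variable {A : AbelianVariety ℂ} {ι : 𝓞 K →+* End A} {θ : K →+* Module.End ℂ (complexBetti A.X 1)}

/-- **`dim A = pq`.** [cite: Shimura1998, §6.2 Theorem 3] -/
theorem dim_eq (φ₀ : K →+* ℂ) (hF : CyclicFrame p q ρ τ κ) (hA : IsCMTypeRealisation Φ A ι θ) :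
    A.dim = p * q :=
  dim_eq_blockType (by rw [← card_gal_eq_finrank φ₀, hF.card_eq]) hA

/-- **`A` is simple iff `Φ` has no non-trivial stabiliser** (Shimura §8.2 Prop. 26: simple ⟺ primitive; Thm. 4.8
(iii)). [cite: Hazama2003CyclicCM, Thm. 4.8 (iii)] [cite: Shimura1998, §8.2 Prop. 26] -/
theorem isSimple_iff (φ₀ : K →+* ℂ) (hA : IsCMTypeRealisation Φ A ι θ) :
    A.IsSimple ↔ ∀ u : K ≃ₐ[ℚ] K, u ≠ 1 → ¬ IsStableUnder 𝓖[φ₀, Φ] u := by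
  rw [isSimple_iff_isPrimitive hA φ₀, isPrimitive_iff (φ₀ := φ₀) Φ φ₀]

/-- The separation hypothesis of the tree's `exists_exceptional_iff_of_primitive` from "no non-trivial stabiliser".
[cite: Shimura1998, §8.2 Prop. 26] -/
theorem separating_of_forall_not_isStableUnder (Φ : CMType K)
    (hprim : ∀ u : K ≃ₐ[ℚ] K, u ≠ 1 → ¬ IsStableUnder 𝓖[φ₀, Φ] u) :
    ∀ s t : K →+* ℂ, (∀ γ : ℂ ≃+* ℂ, ((γ : ℂ →+* ℂ).comp s ∈ Φ.1 ↔ (γ : ℂ →+* ℂ).comp t ∈ Φ.1)) → s = t := by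
  haveI := isPretransitive_ringEquiv_complex (K := K)
  have hP := (isPrimitive_iff (φ₀ := φ₀) Φ φ₀).2 hprim
  rw [isPrimitive_iff_forall_eq] at hP
  intro s t hst
  exact hP s t fun γ => by simpa [ringEquiv_smul_def] using hst γ

/-- **THEOREM 4.8 (iv) with §5 and Pohlmann's criterion: an exceptional Hodge class of codimension `p` ON `A`.**  If
`Φ` is PRIMITIVE and `p`-DOMINATED, every abelian variety `A` of type `(K; Φ)` — simple, of dimension `pq` — carries a
rational `(p,p)`-class OUTSIDE `Dᵖ(A) ⊗ ℂ`: the §5 kernel element `Δ(0,1) = {σ_{τˣ}} ∪ {σ_{ρτˣκ}}` (`2p`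
embeddings, height one) is Galois-balanced (`isBalanced_hazamaSet`) and contains `σ_1` but not `σ̄_1 = σ_ρ`.
[cite: Hazama2003CyclicCM, Thm. 4.8 (iv), §5 (p. 596–597) and Rem. 4.10] [cite: Gordon1999HodgeAVSurvey, 9.2.2]
[cite: Pohlmann1968, Thm. 1 and §3] -/
theorem exists_exceptional_of_hasConstantRows [IsCMField K] (hF : CyclicFrame p q ρ τ κ)
    (hρ : ∀ x, φ₀ (ρ x) = starRingEnd ℂ (φ₀ x))
    (hprim : ∀ u : K ≃ₐ[ℚ] K, u ≠ 1 → ¬ IsStableUnder 𝓖[φ₀, Φ] u)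
    (hr : haveI : NeZero p := ⟨hF.prime_left.ne_zero⟩; HasConstantRows p q 𝓖[φ₀, Φ] τ κ)
    (hA : IsCMTypeRealisation Φ A ι θ) :
    ∃ c : complexBetti A.X (2 * p), IsRationalClass c ∧ IsOfHodgeType (p * q) A.X (2 * p) p p c ∧
      c ∉ divisorClassesSpan A.X (p * q) p := by
  haveI : NeZero p := ⟨hF.prime_left.ne_zero⟩
  haveI : NeZero q := ⟨hF.prime_right.ne_zero⟩
  haveI : Fact (1 < q) := ⟨hF.prime_right.one_lt⟩
  have h := isCMTypeWith_galType hρ Φ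
  have hinj := (embOf_bijective φ₀).1
  -- the kernel element `Δ(0, 1)` on the Galois group and its image in `Hom(K, ℂ)`
  set ΔG : Finset (K ≃ₐ[ℚ] K) := hazamaSet p ρ τ κ (0 : ZMod q) 1 with hΔG
  set Δ : Finset (K →+* ℂ) := ΔG.image (embOf φ₀) with hΔ
  have hcard : Δ.card = 2 * p := by rw [hΔ, Finset.card_image_of_injective _ hinj, hΔG, card_hazamaSet hF]
  -- Galois-balanced: `γ ∘ σ_d ∈ Φ ↔ δ⁻¹ d ∈ 𝓖` for `γ ∘ φ₀ = φ₀ ∘ δ`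
  have hbalG := (isBalanced_indicator_iff 𝓖[φ₀, Φ] ΔG).1 (isBalanced_hazamaSet hF h hr 0 1)
  have hbal : IsGaloisBalanced Φ Δ := by
    rw [isGaloisBalanced_iff_two_mul]
    intro γ
    obtain ⟨δ, hδ⟩ := exists_algEquiv_comp_eq_smul φ₀ γ
    have hset : {s : K →+* ℂ | s ∈ Δ ∧ (γ : ℂ →+* ℂ).comp s ∈ Φ.1} =
        ↑((ΔG.filter fun d => δ⁻¹ * d ∈ 𝓖[φ₀, Φ]).image (embOf φ₀)) := by
      ext s
      simp only [Set.mem_setOf_eq, Finset.coe_image, Finset.coe_filter, Set.mem_image, hΔ, Finset.mem_image]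
      constructor
      · rintro ⟨⟨d, hd, rfl⟩, hs⟩
        refine ⟨d, ⟨hd, ?_⟩, rfl⟩
        rw [mem_galType_iff, mul_comm, ← smul_embOf_of_comp φ₀ hδ, ringEquiv_smul_def]
        exact hs
      · rintro ⟨d, ⟨hd, hd'⟩, rfl⟩
        refine ⟨⟨d, hd, rfl⟩, ?_⟩
        rw [mem_galType_iff, mul_comm, ← smul_embOf_of_comp φ₀ hδ, ringEquiv_smul_def] at hd'
        exact hd'
    rw [hset, Set.ncard_coe_finset, Finset.card_image_of_injective _ hinj, hcard, ← card_hazamaSet hF 0 1]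
    exact hbalG δ⁻¹
  -- not conjugation-symmetric
  have hns : ∃ φ ∈ Δ, ComplexEmbedding.conjugate φ ∉ Δ := by
    obtain ⟨d, hd, hnd⟩ := exists_mem_hazamaSet_rho_mul_not_mem hF (show (0 : ZMod q) ≠ 1 from zero_ne_one)
    refine ⟨embOf φ₀ d, Finset.mem_image_of_mem _ hd, fun hc => hnd ?_⟩
    rw [conjugate_embOf gal_comm hρ, hΔ, Finset.mem_image] at hc
    obtain ⟨d', hd', he⟩ := hc
    rw [← hinj he]
    exact hd'
  have key := (exists_exceptional_iff_of_primitive hA (separating_of_forall_not_isStableUnder Φ hprim) p).2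
    ⟨Δ, ⟨hcard, hbal⟩, hns⟩
  rwa [finrank_div_two_eq φ₀ hF] at key

/-- **THEOREM 4.8 (v): the `q`-dominated case** — a rational `(q,q)`-class outside `D^q(A) ⊗ ℂ`.
[cite: Hazama2003CyclicCM, Thm. 4.8 (v) and §5] [cite: Gordon1999HodgeAVSurvey, 9.2.2] -/
theorem exists_exceptional_of_hasConstantCols [IsCMField K] (hF : CyclicFrame p q ρ τ κ)
    (hρ : ∀ x, φ₀ (ρ x) = starRingEnd ℂ (φ₀ x))
    (hprim : ∀ u : K ≃ₐ[ℚ] K, u ≠ 1 → ¬ IsStableUnder 𝓖[φ₀, Φ] u)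
    (hc : haveI : NeZero q := ⟨hF.prime_right.ne_zero⟩; HasConstantRows q p 𝓖[φ₀, Φ] κ τ)
    (hA : IsCMTypeRealisation Φ A ι θ) :
    ∃ c : complexBetti A.X (2 * q), IsRationalClass c ∧ IsOfHodgeType (p * q) A.X (2 * q) q q c ∧
      c ∉ divisorClassesSpan A.X (p * q) q := by
  rw [mul_comm p q]
  exact exists_exceptional_of_hasConstantRows hF.swap hρ hprim hc hA

/-- **REMARK 4.10 for the cyclic CM fields of degree `2pq`, constructively**: if `Φ` is PRIMITIVE and DEGENERATE,
every abelian variety of type `(K; Φ)` carries a nondivisorial Hodge class ON `A` ITSELF — a rational `(m,m)`-class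
outside `Dᵐ(A) ⊗ ℂ` with `m = p` or `m = q`. [cite: Hazama2003CyclicCM, Rem. 4.10 and Thm. 4.8 (iv)–(v)]
[cite: Gordon1999HodgeAVSurvey, 9.2.2] -/
theorem exists_exceptional_of_not_isNondegenerate [IsCMField K] (hF : CyclicFrame p q ρ τ κ)
    (hρ : ∀ x, φ₀ (ρ x) = starRingEnd ℂ (φ₀ x))
    (hprim : ∀ u : K ≃ₐ[ℚ] K, u ≠ 1 → ¬ IsStableUnder 𝓖[φ₀, Φ] u) (hdeg : ¬ IsNondegenerate Φ)
    (hA : IsCMTypeRealisation Φ A ι θ) :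
    ∃ m : ℕ, (m = p ∨ m = q) ∧ ∃ c : complexBetti A.X (2 * m), IsRationalClass c ∧
      IsOfHodgeType (p * q) A.X (2 * m) m m c ∧ c ∉ divisorClassesSpan A.X (p * q) m := by
  rcases (not_isNondegenerate_iff_of_primitive hF hρ Φ hprim).1 hdeg with ⟨hr, -⟩ | ⟨hc, -⟩
  · exact ⟨p, Or.inl rfl, exists_exceptional_of_hasConstantRows hF hρ hprim hr hA⟩
  · exact ⟨q, Or.inr rfl, exists_exceptional_of_hasConstantCols hF hρ hprim hc hA⟩

/-- **The nondegenerate side of THEOREM 4.8 (ii) on abelian varieties**: if `Φ ∉ S₁ ∪ S_p ∪ S_q` then `A` is simple of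
dimension `pq` and EVERY power `Aᵏ` satisfies the Hodge conjecture (White–Hazama, tree
`IsNondegenerate.hodgeConjectureFor_pow`), unconditionally. [cite: Hazama2003CyclicCM, Thm. 4.8 (ii)]
[cite: Gordon1999HodgeAVSurvey, Thm. 6.4 and §9.3] -/
theorem hodgeConjectureFor_pow_of_not_mem [IsCMField K] (hF : CyclicFrame p q ρ τ κ) (hρ : ∀ x, φ₀ (ρ x) = starRingEnd ℂ (φ₀ x))
    (hnr : haveI : NeZero p := ⟨hF.prime_left.ne_zero⟩; ¬ HasConstantRows p q 𝓖[φ₀, Φ] τ κ)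
    (hnc : haveI : NeZero q := ⟨hF.prime_right.ne_zero⟩; ¬ HasConstantRows q p 𝓖[φ₀, Φ] κ τ)
    (hnτ : ¬ IsStableUnder 𝓖[φ₀, Φ] τ) (hnκ : ¬ IsStableUnder 𝓖[φ₀, Φ] κ)
    (hA : IsCMTypeRealisation Φ A ι θ) :
    A.IsSimple ∧ A.dim = p * q ∧
      ∀ k : ℕ, HodgeConjectureFor (⨁ fun _ : Fin k => A).dim (⨁ fun _ : Fin k => A).X := by
  have hnd := (isNondegenerate_iff hF hρ Φ).2 ⟨hnr, hnc, hnτ, hnκ⟩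
  exact ⟨(isSimple_iff_isPrimitive hA φ₀).2 (hnd.isPrimitive φ₀), dim_eq φ₀ hF hA,
    fun k => hnd.hodgeConjectureFor_pow hA k⟩

end AbelianVarieties

/-! ## §4 REMARK 4.9: primitive degenerate types on every cyclic CM field of degree `2pq`, and simple degenerate
abelian `pq`-folds with `Bᵖ ≠ Dᵖ` for every pair of distinct odd primes -/

section Existence

/-- **REMARK 4.9 for every cyclic CM field of degree `2pq`**: `K` carries a CM type `Φ` which is PRIMITIVE and
DEGENERATE (`p`-dominated, of rank `(p − 1)q + 2 < pq + 1`), and EVERY abelian variety of type `(K; Φ)` is a SIMPLE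
abelian variety of dimension `pq` carrying a rational `(p,p)`-class outside `Dᵖ ⊗ ℂ` («there is always a degenerate
CM-type … whenever `n` is the product of three and an odd prime» is `p = 3`; Hazama's §6 matrix `a_{i1} = 1`).
[cite: Hazama2003CyclicCM, Rem. 4.9, Thm. 4.8 (iv) and §6] [cite: Gordon1999HodgeAVSurvey, 9.2.2] -/
theorem exists_primitive_degenerate [IsCMField K] (hF : CyclicFrame p q ρ τ κ) (hρ : ∀ x, φ₀ (ρ x) = starRingEnd ℂ (φ₀ x)) :
    ∃ Φ : CMType K, (∀ φh : K →+* ℂ, IsPrimitive (ℂ ≃+* ℂ) Φ.1 φh) ∧ ¬ IsNondegenerate Φ ∧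
      cmTypeRank Φ = (p - 1) * q + 2 ∧
      ∀ (A : AbelianVariety ℂ) (ι : 𝓞 K →+* End A) (θ : K →+* Module.End ℂ (complexBetti A.X 1)),
        IsCMTypeRealisation Φ A ι θ →
          A.IsSimple ∧ A.dim = p * q ∧
            ∃ c : complexBetti A.X (2 * p), IsRationalClass c ∧ IsOfHodgeType (p * q) A.X (2 * p) p p c ∧
              c ∉ divisorClassesSpan A.X (p * q) p := by
  haveI : NeZero p := ⟨hF.prime_left.ne_zero⟩
  obtain ⟨ΦG, hcm, hr, hprim⟩ := exists_primitive_hasConstantRows hF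
  obtain ⟨Φ, hΦ⟩ := exists_cmType_of_isCMTypeWith (φ₀ := φ₀) hρ hcm
  have hprim' : ∀ u : K ≃ₐ[ℚ] K, u ≠ 1 → ¬ IsStableUnder 𝓖[φ₀, Φ] u := by rw [hΦ]; exact hprim
  have hr' : HasConstantRows p q 𝓖[φ₀, Φ] τ κ := by rw [hΦ]; exact hr
  exact ⟨Φ, fun φh => (isPrimitive_iff (φ₀ := φ₀) Φ φh).2 hprim', not_isNondegenerate_of_hasConstantRows hF hρ Φ hr',
    cmTypeRank_eq_of_hasConstantRows hF hρ Φ hprim' hr',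
    fun A ι θ hA => ⟨(isSimple_iff φ₀ hA).2 hprim', dim_eq φ₀ hF hA,
      exists_exceptional_of_hasConstantRows hF hρ hprim' hr' hA⟩⟩

/-- **Such abelian varieties exist over `K`** (Shimura §6.2 Thm. 3 = tree `exists_isCMTypeRealisation`): a simple
abelian `pq`-fold of a primitive degenerate CM type of `K` of rank `(p − 1)q + 2` with a rational `(p,p)`-class
outside `Dᵖ ⊗ ℂ`. [cite: Hazama2003CyclicCM, Rem. 4.9–4.10 and Thm. 4.8 (iv)] [cite: Shimura1998, §6.2 Theorem 3] -/
theorem exists_realisation_primitive_degenerate [IsCMField K] (hF : CyclicFrame p q ρ τ κ)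
    (hρ : ∀ x, φ₀ (ρ x) = starRingEnd ℂ (φ₀ x)) :
    ∃ (Φ : CMType K) (A : AbelianVariety ℂ) (ι : 𝓞 K →+* End A) (θ : K →+* Module.End ℂ (complexBetti A.X 1)),
      IsCMTypeRealisation Φ A ι θ ∧ (∀ φh : K →+* ℂ, IsPrimitive (ℂ ≃+* ℂ) Φ.1 φh) ∧ ¬ IsNondegenerate Φ ∧
        cmTypeRank Φ = (p - 1) * q + 2 ∧ A.IsSimple ∧ A.dim = p * q ∧
          ∃ c : complexBetti A.X (2 * p), IsRationalClass c ∧ IsOfHodgeType (p * q) A.X (2 * p) p p c ∧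
            c ∉ divisorClassesSpan A.X (p * q) p := by
  obtain ⟨Φ, hprim, hdeg, hrank, hall⟩ := exists_primitive_degenerate hF hρ
  obtain ⟨A, ι, θ, hA⟩ := exists_isCMTypeRealisation Φ
  exact ⟨Φ, A, ι, θ, hA, hprim, hdeg, hrank, hall A ι θ hA⟩

end Existence

/-! ## §5 (lit-deligne-3 gen 68) HAZAMA'S COUNT: the `q(q − 1)` kernel sets `Δ(y₁, y₂)`, `y₁ ≠ y₂`, are pairwise
distinct sporadic weights, so `dim Bᵖ(A) − dim Dᵖ(A) ≥ q(q − 1)` for every primitive `p`-dominated type -/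

section HazamaCount

open Literature.AlgebraicGeometry.VanGeemen1994 (hodgeClassSpan)

variable {Φ : CMType K}
variable {A : AbelianVariety ℂ} {ι : 𝓞 K →+* End A} {θ : K →+* Module.End ℂ (complexBetti A.X 1)}

omit [Normal ℚ K] in
/-- **The kernel sets `Δ(y₁, y₂)` are pairwise distinct**: `(y₁, y₂) ↦ Δ(y₁, y₂) = {τˣκ^{y₁}} ∪ {ρτˣκ^{y₂}}` is injective on
`ℤ/q × ℤ/q` — the even half determines `y₁`, the odd half `y₂` (coordinates `τˣκʸ` of the odd part; `ρ` is not in the odd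
part).  With `y₁ ≠ y₂` these are the `q(q − 1)` two-coset supports of the weight-`p` `{0, ±1}`-vectors `±w_k^{(2q)}` (`y₁ = 0` or
`y₂ = 0`: `2(q−1)` of them) and `w_k^{(2q)} − w_l^{(2q)}` (`(q−1)(q−2)` of them) of the lattice `V_{2q} ∩ ℤ[ℤ/2nℤ] = ⟨w_k^{(2q)}⟩_ℤ`
(«the coefficient of `[a]` appearing in `w` is equal to `±c_a`»). [cite: Hazama2003CyclicCM, Prop. 3.2 (3.2)–(3.4) and §5 (5.2)–(5.3)] -/
theorem hazamaSet_injective (hF : CyclicFrame p q ρ τ κ) :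
    haveI : NeZero p := ⟨hF.prime_left.ne_zero⟩
    Function.Injective fun y : ZMod q × ZMod q => hazamaSet p ρ τ κ y.1 y.2 := by
  haveI : NeZero p := ⟨hF.prime_left.ne_zero⟩
  rintro ⟨y₁, y₂⟩ ⟨y₁', y₂'⟩ h
  simp only at h
  have h1 : τ ^ (0 : ZMod p).val * κ ^ y₁.val ∈ hazamaSet p ρ τ κ y₁' y₂' := by
    rw [← h]
    unfold hazamaSet
    exact Finset.mem_union_left _ (Finset.mem_image.2 ⟨0, Finset.mem_univ _, rfl⟩)
  have h2 : ρ * (τ ^ (0 : ZMod p).val * κ ^ y₂.val) ∈ hazamaSet p ρ τ κ y₁' y₂' := by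
    rw [← h]
    unfold hazamaSet
    exact Finset.mem_union_right _ (Finset.mem_image.2 ⟨0, Finset.mem_univ _, rfl⟩)
  unfold hazamaSet at h1 h2
  rw [Finset.mem_union] at h1 h2
  have hy₁ : y₁ = y₁' := by
    rcases h1 with h1 | h1
    · obtain ⟨x, -, he⟩ := Finset.mem_image.1 h1
      exact ((Prod.ext_iff.1 (hF.pow_mul_pow_injective (a₁ := (x, y₁')) (a₂ := (0, y₁)) he)).2).symm
    · obtain ⟨x, -, he⟩ := Finset.mem_image.1 h1
      exact (hF.pow_mul_pow_ne_rho_mul _ _ _ _ he.symm).elim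
  have hy₂ : y₂ = y₂' := by
    rcases h2 with h2 | h2
    · obtain ⟨x, -, he⟩ := Finset.mem_image.1 h2
      exact (hF.pow_mul_pow_ne_rho_mul _ _ _ _ he).elim
    · obtain ⟨x, -, he⟩ := Finset.mem_image.1 h2
      exact ((Prod.ext_iff.1 (hF.pow_mul_pow_injective (a₁ := (x, y₂')) (a₂ := (0, y₂)) (mul_left_cancel he))).2).symm
  rw [hy₁, hy₂]

/-- **HAZAMA'S COUNT, AS A LOWER BOUND ON EVERY REALISATION: `dim Bᵖ(A) − dim Dᵖ(A) ≥ q(q − 1)`.**  If `Φ` is PRIMITIVE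
and `p`-DOMINATED (constant row sums), then on every abelian variety `A` of type `(K; Φ)` the `q(q − 1)` sets
`Δ(y₁, y₂) ⊂ Hom(K, ℂ)`, `y₁ ≠ y₂`, are pairwise distinct (`hazamaSet_injective`), Galois-balanced of cardinality `2p`
(`isBalanced_hazamaSet`: Hazama's kernel elements) and not closed under complex conjugation (height one), hence
`q(q − 1)` distinct members of White's set `{Δ : Δ − Δ̄ ≠ ∅, |gΔ ∩ Φ| = p ∀ g}` whose cardinality is `dim Bᵖ(A) − dim Dᵖ(A)`
(Gordon 9.2.2, tree `finrank_hodgeClassSpan_sub_finrank_divisorClassesSpan_of_primitive`).  In print: the proper Hodge cycles of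
weight `p` on `A_S`, `S ∈ S_p − S_1`, correspond to the `{0, ±1}`-vectors of weight `p` in `V_{2q} ∩ ℤ[ℤ/2nℤ] = ⟨w_k^{(2q)} : 1 ≤ k ≤ q − 1⟩_ℤ`,
namely `±w_k^{(2q)}` and `w_k^{(2q)} − w_l^{(2q)}` (`k ≠ l`) — `2(q−1) + (q−1)(q−2) = q(q−1)` of them; the lane's general form (any abelian CM
field, any admissible kernel with an odd prime factor: `≥ [G:H]·Π(p_i−1)/2`) is `MixedDifferenceCubeExponentFamilies`.
[cite: Hazama2003CyclicCM, Prop. 3.2, Thm. 4.8 (iv), §5 (p. 596–597)] [cite: Gordon1999HodgeAVSurvey, 9.2.2] [cite: Pohlmann1968, Thm. 1] -/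
theorem mul_sub_one_le_finrank_sub_of_hasConstantRows [IsCMField K] (hF : CyclicFrame p q ρ τ κ)
    (hρ : ∀ x, φ₀ (ρ x) = starRingEnd ℂ (φ₀ x))
    (hprim : ∀ u : K ≃ₐ[ℚ] K, u ≠ 1 → ¬ IsStableUnder 𝓖[φ₀, Φ] u)
    (hr : haveI : NeZero p := ⟨hF.prime_left.ne_zero⟩; HasConstantRows p q 𝓖[φ₀, Φ] τ κ)
    (hA : IsCMTypeRealisation Φ A ι θ) :
    q * (q - 1) ≤ Module.finrank ℂ ↥(hodgeClassSpan (p * q) A.X p) -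
      Module.finrank ℂ ↥(divisorClassesSpan A.X (p * q) p) := by
  haveI : NeZero p := ⟨hF.prime_left.ne_zero⟩
  haveI : NeZero q := ⟨hF.prime_right.ne_zero⟩
  have h := isCMTypeWith_galType hρ Φ
  have hinj := (embOf_bijective φ₀).1
  -- the sets `Δ(y₁, y₂) ⊂ Hom(K, ℂ)`
  set D : ZMod q × ZMod q → Finset (K →+* ℂ) := fun y => (hazamaSet p ρ τ κ y.1 y.2).image (embOf φ₀) with hDdef
  have hcard : ∀ y, (D y).card = 2 * p := fun y => by
    rw [hDdef]
    simp only
    rw [Finset.card_image_of_injective _ hinj, card_hazamaSet hF]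
  -- Galois-balanced (transport `γ ∘ σ_d ∈ Φ ↔ δ⁻¹ d ∈ 𝓖` for `γ ∘ φ₀ = φ₀ ∘ δ`, as in `exists_exceptional_of_hasConstantRows`)
  have hbal : ∀ y, IsGaloisBalanced Φ (D y) := by
    intro y
    have hbalG := (isBalanced_indicator_iff 𝓖[φ₀, Φ] (hazamaSet p ρ τ κ y.1 y.2)).1 (isBalanced_hazamaSet hF h hr y.1 y.2)
    rw [isGaloisBalanced_iff_two_mul]
    intro γ
    obtain ⟨δ, hδ⟩ := exists_algEquiv_comp_eq_smul φ₀ γ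
    have hset : {s : K →+* ℂ | s ∈ D y ∧ (γ : ℂ →+* ℂ).comp s ∈ Φ.1} =
        ↑(((hazamaSet p ρ τ κ y.1 y.2).filter fun d => δ⁻¹ * d ∈ 𝓖[φ₀, Φ]).image (embOf φ₀)) := by
      ext s
      simp only [Set.mem_setOf_eq, Finset.coe_image, Finset.coe_filter, Set.mem_image, hDdef, Finset.mem_image]
      constructor
      · rintro ⟨⟨d, hd, rfl⟩, hs⟩
        refine ⟨d, ⟨hd, ?_⟩, rfl⟩
        rw [mem_galType_iff, mul_comm, ← smul_embOf_of_comp φ₀ hδ, ringEquiv_smul_def]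
        exact hs
      · rintro ⟨d, ⟨hd, hd'⟩, rfl⟩
        refine ⟨⟨d, hd, rfl⟩, ?_⟩
        rw [mem_galType_iff, mul_comm, ← smul_embOf_of_comp φ₀ hδ, ringEquiv_smul_def] at hd'
        exact hd'
    rw [hset, Set.ncard_coe_finset, Finset.card_image_of_injective _ hinj, hcard, ← card_hazamaSet hF y.1 y.2]
    exact hbalG δ⁻¹
  -- not closed under complex conjugation when `y₁ ≠ y₂`
  have hns : ∀ y : ZMod q × ZMod q, y.1 ≠ y.2 → ∃ φ ∈ D y, ComplexEmbedding.conjugate φ ∉ D y := by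
    rintro ⟨y₁, y₂⟩ hy
    obtain ⟨d, hd, hnd⟩ := exists_mem_hazamaSet_rho_mul_not_mem hF hy
    refine ⟨embOf φ₀ d, Finset.mem_image_of_mem _ hd, fun hc => hnd ?_⟩
    rw [conjugate_embOf gal_comm hρ, hDdef, Finset.mem_image] at hc
    obtain ⟨d', hd', he⟩ := hc
    rw [← hinj he]
    exact hd'
  have hDinj : Function.Injective D := fun y y' hyy =>
    hazamaSet_injective hF (Finset.image_injective hinj hyy)
  rw [← finrank_div_two_eq φ₀ hF,
    finrank_hodgeClassSpan_sub_finrank_divisorClassesSpan_of_primitive hA (separating_of_forall_not_isStableUnder Φ hprim) p]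
  calc q * (q - 1) = ((Finset.univ : Finset (ZMod q)).offDiag).card := by
        rw [Finset.offDiag_card, Finset.card_univ, ZMod.card, Nat.mul_sub_one]
    _ = (((Finset.univ : Finset (ZMod q)).offDiag).image D).card := by
        rw [Finset.card_image_of_injective _ hDinj]
    _ = (↑(((Finset.univ : Finset (ZMod q)).offDiag).image D) : Set (Finset (K →+* ℂ))).ncard :=
        (Set.ncard_coe_finset _).symm
    _ ≤ {Δ | Δ ∈ pohlmannSets Φ p ∧ ∃ φ ∈ Δ, ComplexEmbedding.conjugate φ ∉ Δ}.ncard := by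
        refine Set.ncard_le_ncard (fun T hT => ?_)
        obtain ⟨y, hy, rfl⟩ := Finset.mem_image.1 (Finset.mem_coe.1 hT)
        exact ⟨⟨hcard y, hbal y⟩, hns y (Finset.mem_offDiag.1 hy).2.2⟩

/-- **The `q`-dominated case: `dim B^q(A) − dim D^q(A) ≥ p(p − 1)`** (roles of `p, τ` and `q, κ` exchanged).
[cite: Hazama2003CyclicCM, Prop. 3.2, Thm. 4.8 (v), §5] [cite: Gordon1999HodgeAVSurvey, 9.2.2] -/
theorem mul_sub_one_le_finrank_sub_of_hasConstantCols [IsCMField K] (hF : CyclicFrame p q ρ τ κ)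
    (hρ : ∀ x, φ₀ (ρ x) = starRingEnd ℂ (φ₀ x))
    (hprim : ∀ u : K ≃ₐ[ℚ] K, u ≠ 1 → ¬ IsStableUnder 𝓖[φ₀, Φ] u)
    (hc : haveI : NeZero q := ⟨hF.prime_right.ne_zero⟩; HasConstantRows q p 𝓖[φ₀, Φ] κ τ)
    (hA : IsCMTypeRealisation Φ A ι θ) :
    p * (p - 1) ≤ Module.finrank ℂ ↥(hodgeClassSpan (p * q) A.X q) -
      Module.finrank ℂ ↥(divisorClassesSpan A.X (p * q) q) := by
  rw [mul_comm p q]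
  exact mul_sub_one_le_finrank_sub_of_hasConstantRows hF.swap hρ hprim hc hA

/-- **PRIMITIVE AND DEGENERATE ⟹ at least `q(q−1)` independent nondivisorial `(p,p)`-classes or at least `p(p−1)` independent
nondivisorial `(q,q)`-classes on `A` itself** (Thm. 4.8 (ii)–(v): a primitive degenerate type is `p`- or `q`-dominated).
[cite: Hazama2003CyclicCM, Thm. 4.8 (ii)–(v), Prop. 3.2, §5 and Rem. 4.10] [cite: Gordon1999HodgeAVSurvey, 9.2.2] -/
theorem mul_sub_one_le_finrank_sub_of_not_isNondegenerate [IsCMField K] (hF : CyclicFrame p q ρ τ κ)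
    (hρ : ∀ x, φ₀ (ρ x) = starRingEnd ℂ (φ₀ x))
    (hprim : ∀ u : K ≃ₐ[ℚ] K, u ≠ 1 → ¬ IsStableUnder 𝓖[φ₀, Φ] u) (hdeg : ¬ IsNondegenerate Φ)
    (hA : IsCMTypeRealisation Φ A ι θ) :
    q * (q - 1) ≤ Module.finrank ℂ ↥(hodgeClassSpan (p * q) A.X p) -
        Module.finrank ℂ ↥(divisorClassesSpan A.X (p * q) p) ∨
      p * (p - 1) ≤ Module.finrank ℂ ↥(hodgeClassSpan (p * q) A.X q) -
        Module.finrank ℂ ↥(divisorClassesSpan A.X (p * q) q) := by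
  rcases (not_isNondegenerate_iff_of_primitive hF hρ Φ hprim).1 hdeg with ⟨hr, -⟩ | ⟨hc, -⟩
  · exact Or.inl (mul_sub_one_le_finrank_sub_of_hasConstantRows hF hρ hprim hr hA)
  · exact Or.inr (mul_sub_one_le_finrank_sub_of_hasConstantCols hF hρ hprim hc hA)

end HazamaCount

end CyclicTwoOddPrimes

/-! ### For every pair of distinct odd primes -/

section AllPairs

open Literature.NumberTheory.ComplexMultiplication
open Literature.NumberTheory.ComplexMultiplication.CyclicCMType
open Literature.AlgebraicGeometry.Motives (AbelianVariety CMType)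
open Literature.AlgebraicGeometry.HodgeTheory
open Literature.AlgebraicGeometry.ComplexMultiplication (IsCMTypeRealisation)
open Literature.Barriers.HodgeConjecture (divisorClassesSpan)

/-- **Simple degenerate abelian `pq`-folds with an exceptional Hodge class of codimension `p` EXIST for every pair of
distinct odd primes `p, q`** (Hazama Thm. 4.8 (iv) + Rem. 4.9 on Dodson's cyclic CM fields of degree `2pq`, which
exist for every degree — tree `Dodson1984.exists_abelianCMField_gal_cyclicTimesConj` — with Shimura's existence
theorem): a CM field `K` of degree `2pq` with commutative Galois group, a primitive degenerate CM type `Φ` of `K` of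
rank `(p − 1)q + 2`, and a SIMPLE abelian variety `A` of type `(K; Φ)`, `dim A = pq`, with a rational `(p,p)`-class
outside `Dᵖ(A) ⊗ ℂ`. [cite: Hazama2003CyclicCM, Thm. 4.8 (iv) and Rem. 4.9–4.10] [cite: Dodson1984, §3.2.1]
[cite: Shimura1998, §6.2 Theorem 3] -/
theorem exists_simple_exceptional_codim {p q : ℕ} (hp : p.Prime) (hq : q.Prime) (hpq : p ≠ q) (hp2 : p ≠ 2)
    (hq2 : q ≠ 2) :
    ∃ (K : Type) (_ : Field K) (_ : NumberField K) (_ : IsCMField K) (_ : IsGalois ℚ K)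
      (Φ : CMType K) (A : AbelianVariety ℂ) (ι : 𝓞 K →+* End A) (θ : K →+* Module.End ℂ (complexBetti A.X 1)),
      (∀ g h : K ≃ₐ[ℚ] K, g * h = h * g) ∧ Module.finrank ℚ K = 2 * (p * q) ∧
        IsCMTypeRealisation Φ A ι θ ∧ (∀ φh : K →+* ℂ, IsPrimitive (ℂ ≃+* ℂ) Φ.1 φh) ∧ ¬ IsNondegenerate Φ ∧
        cmTypeRank Φ = (p - 1) * q + 2 ∧ A.IsSimple ∧ A.dim = p * q ∧
          ∃ c : complexBetti A.X (2 * p), IsRationalClass c ∧ IsOfHodgeType (p * q) A.X (2 * p) p p c ∧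
            c ∉ divisorClassesSpan A.X (p * q) p := by
  obtain ⟨K, iF, iN, iCM, iG, ρ, σ, φ₀, hcomm, hρ, hσ, -, hK⟩ :=
    Dodson1984.exists_abelianCMField_gal_cyclicTimesConj (p * q) (Nat.mul_pos hp.pos hq.pos)
  haveI : IsMulCommutative (K ≃ₐ[ℚ] K) := IsMulCommutative.of_comm hcomm
  -- `τ = σ^q` has order `p`, `κ = σ^p` has order `q`
  have hτ : orderOf (σ ^ q) = p := by
    rw [orderOf_pow' σ hq.ne_zero, hσ, Nat.gcd_eq_right (dvd_mul_left q p), Nat.mul_div_cancel _ hq.pos]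
  have hκ : orderOf (σ ^ p) = q := by
    rw [orderOf_pow' σ hp.ne_zero, hσ, Nat.gcd_eq_right (dvd_mul_right p q), Nat.mul_div_cancel_left _ hp.pos]
  have hF := CyclicTwoOddPrimes.cyclicFrame_gal hρ hp hq hpq hp2 hq2 hK hτ hκ
  obtain ⟨Φ, A, ι, θ, hA, hprim, hdeg, hrank, hsimple, hdim, hc⟩ :=
    CyclicTwoOddPrimes.exists_realisation_primitive_degenerate hF hρ
  exact ⟨K, iF, iN, iCM, iG, Φ, A, ι, θ, hcomm, hK, hA, hprim, hdeg, hrank, hsimple, hdim, hc⟩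

end AllPairs

/-! ### (gen 68) For every pair of distinct odd primes: simple CM `pq`-folds with `dim Bᵖ − dim Dᵖ ≥ q(q − 1)` -/

section AllPairsCount

open Literature.NumberTheory.ComplexMultiplication
open Literature.NumberTheory.ComplexMultiplication.CyclicCMType
open Literature.AlgebraicGeometry.Motives (AbelianVariety CMType)
open Literature.AlgebraicGeometry.HodgeTheory
open Literature.AlgebraicGeometry.ComplexMultiplication (IsCMTypeRealisation exists_isCMTypeRealisation)
open Literature.AlgebraicGeometry.VanGeemen1994 (hodgeClassSpan)
open Literature.Barriers.HodgeConjecture (divisorClassesSpan)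

/-- **For every pair of distinct odd primes `p, q` there is a SIMPLE CM abelian `pq`-fold `A` with at least `q(q − 1)` linearly
independent Hodge classes of codimension `p` outside the divisor ring** (`dim Bᵖ(A) − dim Dᵖ(A) ≥ q(q−1)`): Dodson's CM field of degree
`2pq` with cyclic-times-conjugation Galois group, a primitive `p`-dominated type (Rem. 4.9, §6), Shimura's existence theorem, and §5.
[cite: Hazama2003CyclicCM, Thm. 4.8 (iv), Prop. 3.2, §5 and Rem. 4.9] [cite: Dodson1984, §3.2.1] [cite: Shimura1998, §6.2 Theorem 3]
[cite: Gordon1999HodgeAVSurvey, 9.2.2] -/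
theorem exists_simple_mul_sub_one_le_finrank_sub {p q : ℕ} (hp : p.Prime) (hq : q.Prime) (hpq : p ≠ q) (hp2 : p ≠ 2)
    (hq2 : q ≠ 2) :
    ∃ (K : Type) (_ : Field K) (_ : NumberField K) (_ : IsCMField K) (_ : IsGalois ℚ K)
      (Φ : CMType K) (A : AbelianVariety ℂ) (ι : 𝓞 K →+* End A) (θ : K →+* Module.End ℂ (complexBetti A.X 1)),
      Module.finrank ℚ K = 2 * (p * q) ∧ IsCMTypeRealisation Φ A ι θ ∧ A.IsSimple ∧ A.dim = p * q ∧
        q * (q - 1) ≤ Module.finrank ℂ ↥(hodgeClassSpan (p * q) A.X p) -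
          Module.finrank ℂ ↥(divisorClassesSpan A.X (p * q) p) := by
  obtain ⟨K, iF, iN, iCM, iG, ρ, σ, φ₀, hcomm, hρ, hσ, -, hK⟩ :=
    Dodson1984.exists_abelianCMField_gal_cyclicTimesConj (p * q) (Nat.mul_pos hp.pos hq.pos)
  haveI : IsMulCommutative (K ≃ₐ[ℚ] K) := IsMulCommutative.of_comm hcomm
  have hτ : orderOf (σ ^ q) = p := by
    rw [orderOf_pow' σ hq.ne_zero, hσ, Nat.gcd_eq_right (dvd_mul_left q p), Nat.mul_div_cancel _ hq.pos]
  have hκ : orderOf (σ ^ p) = q := by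
    rw [orderOf_pow' σ hp.ne_zero, hσ, Nat.gcd_eq_right (dvd_mul_right p q), Nat.mul_div_cancel_left _ hp.pos]
  have hF := CyclicTwoOddPrimes.cyclicFrame_gal hρ hp hq hpq hp2 hq2 hK hτ hκ
  haveI : NeZero p := ⟨hp.ne_zero⟩
  obtain ⟨ΦG, hcm, hr, hprim⟩ := exists_primitive_hasConstantRows hF
  obtain ⟨Φ, hΦ⟩ := CyclicTwoOddPrimes.exists_cmType_of_isCMTypeWith (φ₀ := φ₀) hρ hcm
  have hprim' : ∀ u : K ≃ₐ[ℚ] K, u ≠ 1 →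
      ¬ IsStableUnder (Finset.filter (fun g => embOf φ₀ g ∈ (Φ : CMType K).1) Finset.univ) u := by
    rw [hΦ]; exact hprim
  have hr' : HasConstantRows p q (Finset.filter (fun g => embOf φ₀ g ∈ (Φ : CMType K).1) Finset.univ) (σ ^ q) (σ ^ p) := by
    rw [hΦ]; exact hr
  obtain ⟨A, ι, θ, hA⟩ := exists_isCMTypeRealisation Φ
  exact ⟨K, iF, iN, iCM, iG, Φ, A, ι, θ, hK, hA, (CyclicTwoOddPrimes.isSimple_iff φ₀ hA).2 hprim',
    CyclicTwoOddPrimes.dim_eq φ₀ hF hA, CyclicTwoOddPrimes.mul_sub_one_le_finrank_sub_of_hasConstantRows hF hρ hprim' hr' hA⟩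

end AllPairsCount

end Literature.AlgebraicGeometry.Pohlmann1968

end
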